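/-
Copyright (c) 2026 the pub-hodgecm-mathlib formalisation cell (harness21).  Prover seat hodgecm-mathlib-K2E2-p13 (g2),
Track B «K2-LIT» ∕ h413 (stmt-HodgeConjecture-24833), line K2_E2 «ThetaExhaustionByRigidity», unit CAPTURE, socket #20a «ARCH-PAIR-HOLCOT»
(road b2), helper H4b-K «MIRROR AT PKG» (split off H4b by its holder K2E4-p11 (g2), 2026-09-04T00:50:48Z).  KERNEL module: THEOREMS ONLY
(no definition, no named fact, no `sorry`, no instance, no notation).  2026-09-04.
-/
import Summits.HodgeConjecture.HodgeConjecture.Theorems.K2E2CapArchPairMirrorKit        -- ★ H4a (this seat, p856262): the generic conj laws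
import Summits.HodgeConjecture.HodgeConjecture.Theorems.K2E2CapArchPairMirrorGlue       -- ★ H4b glue (K2E4-p11, p856259): `adelic_JW_neg_eq`
import Summits.HodgeConjecture.HodgeConjecture.Theorems.K2E2CapArchPairFixedNeZero      -- ★ H3 (this seat, p855971): `archWeilRep_congr_splitting`
import Summits.HodgeConjecture.HodgeConjecture.Theorems.H413MirrorAtPinLine             -- ★ `neg_TW_eq`, `neg_JW_eq`, the shape of `hEq`
import Literature.NumberTheory.Automorphic.Liu2021.ThetaLiftFromLineMeets               -- ★ `lineThetaKernelDatum`
import Summits.HodgeConjecture.HodgeConjecture.Theorems.H413ThetaPairRepArchFinFactorisation  -- ★ `ThetaNonvanishing.proj_apply_eq_toSp`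
import HarnessLib

-- statements over the theta-kernel datum elaborate to very large types; elaborate sequentially (as in the lineage).
set_option Elab.async false

/-!
# K2_E2 road (h413 = stmt-HodgeConjecture-24833), unit CAPTURE, socket #20a, helper H4b-K «MIRROR AT PKG»:
# the two mirror identities H4b's assembly `exact`s, at the packaged frame `(frameD V, model e₁)` and the line data `(TW a, JW a)` ∕ `(TW (−a), JW (−a))`

Cell `pub/hodgecm-mathlib` (D-0151), Track B; dealer K2E2-plan (g2); line lead K2E2-p12 (g2); H4b «ORIENTATION MIRROR — ASSEMBLY» is K2E4-p11 (g2)'s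
(`Theorems/K2E2CapArchPairMirror.lean`), who split the present two heads off to the H4a owner (bus 2026-09-04T00:50:48Z; dealer 00:58:45Z «fine»).
Both theorems are INSTANCES of ★ H4a `K2E2CapArchPairMirrorKit` at the model data of ★ `MirrorAtPinLine.exists_weightOne_mirror_sChiD` — a rank-3 CM
hermitian space `V : HermSpace3 L ι₁`, its diagonal frame `frameD V`, the model enumeration `e₁ = Equiv.prodUnique (Fin 3) (Fin 1)`, a unit `a` of `L⁺`,
two conjugate-symplectic characters `μ`, `μ′` — with the SPLITTING IDENTITY of that ★ lemma taken as the displayed hypothesis `hEq`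
(`splittingCongr (neg_TW_eq a) (neg_JW_eq a) (mirrorSplitting (sChiD μ a)) = sChiD μ′ (−a)`: the mirror of Liu's `μ`-splitting at `⟨a⟩` IS the `μ′`-splitting
at `⟨−a⟩`, [Liu2021, App. D Lem. D.1 (2)]), so that both serve the ONE partner `μ′` the assembly obtains:

* (K1) **`lineThetaKernelDatum_mirror_thetaFun`** — the theta kernel of the LINE datum of `(μ′, −a)` is the complex conjugate of that of `(μ, a)` on conjugate
  test functions, along the identification `U(J_W(−a))(𝔸) = U(J_W(a))(𝔸)` (★ glue `adelic_JW_neg_eq`): ★ kit §3 `thetaKernelDatum_mirror_thetaFun` after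
  `unfold lineThetaKernelDatum` and a `subst`-congruence of ★ `UnitaryDualPair.thetaKernelDatum` in its splitting (`thetaKernelDatum_thetaFun_congr`, §1) along `hEq`.
* (K2) **`archWeilRep_line_schwartzConj_eq_self_of_partner`** — row (E) transfers: if `a″ ∈ U(J_W(−a))(L⁺ ⊗ ℝ)` fixes `Ψ` under the archimedean Weil
  representation of the `μ′`-splitting at `⟨−a⟩` (the #20a (E)-operator VERBATIM at `(frameD V, JW (−a), μ′)`), then the `a′ ∈ U(J_W(a))(L⁺ ⊗ ℝ)` with the
  same matrix fixes `C_∞ Ψ` under the one at `⟨a⟩` (VERBATIM at `(frameD V, JW a, μ)`): ★ kit §2 `archWeilRep_schwartzConj_eq_self_of_mirror_eq_self` +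
  ★ H3 `archWeilRep_congr_splitting` along `hEq`.

HONEST LABEL: HC_CM is proved only modulo the 7 printed citations (2 remaining named inputs: hLiu418 = stmt-HodgeConjecture-24832,
h413 = stmt-HodgeConjecture-24833) until rung 0 closes; this file is a `--supports stmt-HodgeConjecture-24833` helper (H4b-K of #20a's road b2), carrier
bookkeeping only; H4b's assembly and the CLOSER remain with their holders.

## References
* [Liu2021] Y. Liu, Camb. J. Math. 9 (2021) = arXiv:2102.11518: Def. 4.11–4.12, Rem. 4.4, App. D §D.1 Steps 1–3 (l. 5215–5221), Lem. D.1 (2) (l. 5231).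
* [Li1992] J.-S. Li, J. reine angew. Math. 428 (1992), p. 181.  [Kudla1994] S. Kudla, Israel J. Math. 87 (1994), §2.
* [GelbartRogawski1991] S. Gelbart, J. Rogawski, Invent. Math. 105 (1991), §3.1 Prop. 3.1.1 p. 455, Remark p. 457.
* [Weil1964] A. Weil, Acta Math. 111 (1964), Chap. III n° 37–41.
-/

set_option autoImplicit false
-- the mandated namespace repeats the single-problem summit's segment (`HodgeConjecture.HodgeConjecture`)
set_option linter.dupNamespace false

noncomputable section

open NumberField NumberField.InfinitePlace NumberField.mixedEmbedding IsDedekindDomain MeasureTheory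
open scoped Matrix SchwartzMap TensorProduct Classical ComplexConjugate
open Literature.NumberTheory.Automorphic Literature.NumberTheory.Automorphic.UnitaryGroup Literature.NumberTheory.Weil1964
open Literature.NumberTheory.GelbartRogawski1991 Literature.NumberTheory.GelbartRogawski1991.UnitaryDualPair
open Literature.NumberTheory.Automorphic.Liu2021 Literature.NumberTheory.Automorphic.Liu2021.Def411WeilCarriers
open Literature.NumberTheory.Automorphic.Liu2021.Def411WeilCarriersDoubling
open Literature.NumberTheory.Automorphic.IdeleClassGroup
open Literature.RepresentationTheory.Liu2021
open HodgeCM HodgeCM.Model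
open HodgeCM.Model.ArchSideTerm (e₁)
open HodgeCM.WeilCoinv (mirrorSplitting)
open Summit.HodgeConjecture.CorCM.Transposition.OmegaChiSplitting (sChiD hsChiD)
open Summit.HodgeConjecture.HodgeConjecture.Cruxes.H413
open Summit.HodgeConjecture.HodgeConjecture.Cruxes.H413.MirrorAtPinLine (neg_TW_eq neg_JW_eq)

namespace Summit.HodgeConjecture.HodgeConjecture.Cruxes.H413.K2E2CapArchPairMirrorAtPKG

/-! ## §1 Congruence of the unitary dual pair's theta kernel in its splitting -/

section Congr

variable (F E : Type) [Field F] [NumberField F] [Field E] [NumberField E] [Algebra F E] (c : E ≃ₐ[F] E)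
  (N M : ℕ) {n : ℕ} (e : Fin N × Fin M ≃ Fin n) (JV : Matrix (Fin N) (Fin N) E) (JW : Matrix (Fin M) (Fin M) E)
  {TV : Matrix (Fin N) (Fin N) F} {TW : Matrix (Fin M) (Fin M) F}
  [Algebra.IsQuadraticExtension F E] {δ : E} (hcδ : c δ = -δ) (hδ : δ ≠ 0) {d : F} (hd : δ * δ = algebraMap F E d)
  (hV : TV.IsSymm) (hW : TW.IsSymm) (hVd : IsUnit TV.det) (hWd : IsUnit TW.det)
  (hJV : JV = TV.map (algebraMap F E)) (hJW : JW = TW.map (algebraMap F E))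
  [LocallyCompactSpace (UnitaryGroup.adelic F E c N JV)] [LocallyCompactSpace (UnitaryGroup.adelic F E c M JW)]

/-- **the theta kernel of ★ `UnitaryDualPair.thetaKernelDatum` depends on the splitting only through its value** (equal splittings, any proofs of
compatibility ∕ majorants ∕ stability ⇒ equal kernels; `subst`).  Stated POINTWISE (values in `ℂ`), so that no equality of the `s`-dependent
Schwartz carrier types is ever elaborated. [cite: Weil1964, Chap. III n° 41 Thm 6 p. 193] -/
theorem thetaKernelDatum_thetaFun_congr
    {s₁ s₂ : UnitaryGroup.adelicPair F E c N M JV JW →* adelicMpCont F (Fin n) (adelicGram F e TV TW)} (h : s₁ = s₂)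
    (hs₁ : (splittingDatum F E c N M e JV JW hcδ hδ hd hV hW hVd hWd hJV hJW).IsCompatible s₁)
    (hs₂ : (splittingDatum F E c N M e JV JW hcδ hδ hd hV hW hVd hWd hJV hJW).IsCompatible s₂)
    (hρ₁ : HasThetaMajorants fun (p : UnitaryGroup.adelic F E c N JV × UnitaryGroup.adelic F E c M JW) (Φ : piSchwartzBruhat F (Fin n)) =>
      pairRep F E c N M e JV JW s₁ p Φ)
    (hρ₂ : HasThetaMajorants fun (p : UnitaryGroup.adelic F E c N JV × UnitaryGroup.adelic F E c M JW) (Φ : piSchwartzBruhat F (Fin n)) =>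
      pairRep F E c N M e JV JW s₂ p Φ)
    (SK : Set (piSchwartzBruhat F (Fin n)))
    (hSK₁ : ∀ (h : UnitaryGroup.adelic F E c M JW) (Φ : piSchwartzBruhat F (Fin n)), Φ ∈ SK → pairRep F E c N M e JV JW s₁ (1, h) Φ ∈ SK)
    (hSK₂ : ∀ (h : UnitaryGroup.adelic F E c M JW) (Φ : piSchwartzBruhat F (Fin n)), Φ ∈ SK → pairRep F E c N M e JV JW s₂ (1, h) Φ ∈ SK)
    (Φ : piSchwartzBruhat F (Fin n)) (p : UnitaryGroup.adelic F E c N JV × UnitaryGroup.adelic F E c M JW) :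
    (thetaKernelDatum F E c N M e JV JW hcδ hδ hd hV hW hVd hWd hJV hJW s₁ hs₁ hρ₁ SK hSK₁).thetaFun Φ p =
      (thetaKernelDatum F E c N M e JV JW hcδ hδ hd hV hW hVd hWd hJV hJW s₂ hs₂ hρ₂ SK hSK₂).thetaFun Φ p := by
  subst h
  rfl

end Congr

/-! ## §2 At the packaged frame: (K1) the line theta kernel, (K2) row (E) -/

section PKG

variable {L : CMField} {ι₁ : (L : Type) →+* ℂ} (V : HermSpace3 L ι₁)
  (μ μ' : Literature.NumberTheory.Automorphic.IdeleClassGroup (L : Type) →ₜ* Circle)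
  (hμ : IsConjugateSymplectic (L : Type) μ) (hμ' : IsConjugateSymplectic (L : Type) μ')
  (a : (↥(maximalRealSubfield (L : Type)))ˣ)
  (hEq : splittingCongr ↥(maximalRealSubfield (L : Type)) (L : Type) (IsCMField.complexConj (L : Type)) 3 1 e₁ (Matrix.diagonal (frameD V))
      (neg_TW_eq a) (neg_JW_eq a)
      (mirrorSplitting ↥(maximalRealSubfield (L : Type)) (L : Type) (IsCMField.complexConj (L : Type)) 3 1 e₁ (Matrix.diagonal (frameD V))
        (JW ↥(maximalRealSubfield (L : Type)) (L : Type) a)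
        (sChiD (⟨HodgeCM.CMField.K L⟩ : Summit.HodgeConjecture.CorCM.CMField) e₁ (frameD V) (frameD_real V) (frameD_ne V)
          (toHeckeCharacter (L : Type) μ) (isUnitary_toHeckeCharacter (L : Type) μ)
          (isSplittingChar_toHeckeCharacter_of_isConjugateSymplectic (L : Type) μ hμ) a)) =
    sChiD (⟨HodgeCM.CMField.K L⟩ : Summit.HodgeConjecture.CorCM.CMField) e₁ (frameD V) (frameD_real V) (frameD_ne V)
      (toHeckeCharacter (L : Type) μ') (isUnitary_toHeckeCharacter (L : Type) μ')
      (isSplittingChar_toHeckeCharacter_of_isConjugateSymplectic (L : Type) μ' hμ') (-a))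

include hEq in
set_option synthInstance.maxHeartbeats 400000 in
set_option maxHeartbeats 16000000 in
/-- **(K1) THE LINE THETA KERNEL OF THE PARTNER IS THE CONJUGATE**: for the SAME partner `μ′` (`hEq`),
`θ^{line(μ′, −a)}_Φ(x, y′) = conj θ^{line(μ, a)}_{CΦ}(x, ȳ′)`, `ȳ′` = `y′` read in `U(J_W(a))(𝔸)` along ★ `adelic_JW_neg_eq` — ★ kit §3 at
`(hT, hJ) := (neg_TW_eq a, neg_JW_eq a)` after `unfold lineThetaKernelDatum` and §1 along `hEq`; the `hθ` of ★ kit §4 `thetaLift_conj_cosetCongr_apply_map`.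
[cite: Liu2021, App. D Lemma D.1 (2) (l. 5231); §D.1 Step 3 (l. 5221)] [cite: Li1992, p. 181] [cite: Weil1964, Chap. III n° 41 Thm 6 p. 193] -/
theorem lineThetaKernelDatum_mirror_thetaFun
    (hρ : HasThetaMajorants fun
    (p : ↥(UnitaryGroup.adelic (↥(maximalRealSubfield (L : Type))) (L : Type) (IsCMField.complexConj (L : Type)) 3 (Matrix.diagonal (frameD V))) ×
    ↥(UnitaryGroup.adelic (↥(maximalRealSubfield (L : Type))) (L : Type) (IsCMField.complexConj (L : Type)) 1 (JW (↥(maximalRealSubfield (L : Type))) (L : Type) a)))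
    (Φ : piSchwartzBruhat (↥(maximalRealSubfield (L : Type))) (Fin 3)) =>
    pairRep (↥(maximalRealSubfield (L : Type))) (L : Type) (IsCMField.complexConj (L : Type)) 3 1 e₁ (Matrix.diagonal (frameD V)) (JW (↥(maximalRealSubfield (L : Type))) (L : Type) a)
    (chiSplittingLine (L : Type) e₁ (frameD V) (frameD_real V) (frameD_ne V) (toHeckeCharacter (L : Type) μ) (isUnitary_toHeckeCharacter (L : Type) μ)
    ((isOscillatorChar_toHeckeCharacter_iff μ).mpr hμ) (TW (↥(maximalRealSubfield (L : Type))) a)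
    (isUnit_det_TW (↥(maximalRealSubfield (L : Type))) a) (JW (↥(maximalRealSubfield (L : Type))) (L : Type) a) (JW_eq (↥(maximalRealSubfield (L : Type))) (L : Type) a))
    p Φ)
    (hρ' : HasThetaMajorants fun
    (p : ↥(UnitaryGroup.adelic (↥(maximalRealSubfield (L : Type))) (L : Type) (IsCMField.complexConj (L : Type)) 3 (Matrix.diagonal (frameD V))) ×
    ↥(UnitaryGroup.adelic (↥(maximalRealSubfield (L : Type))) (L : Type) (IsCMField.complexConj (L : Type)) 1 (JW (↥(maximalRealSubfield (L : Type))) (L : Type) (-a))))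
    (Φ : piSchwartzBruhat (↥(maximalRealSubfield (L : Type))) (Fin 3)) =>
    pairRep (↥(maximalRealSubfield (L : Type))) (L : Type) (IsCMField.complexConj (L : Type)) 3 1 e₁ (Matrix.diagonal (frameD V)) (JW (↥(maximalRealSubfield (L : Type))) (L : Type) (-a))
    (chiSplittingLine (L : Type) e₁ (frameD V) (frameD_real V) (frameD_ne V) (toHeckeCharacter (L : Type) μ') (isUnitary_toHeckeCharacter (L : Type) μ')
    ((isOscillatorChar_toHeckeCharacter_iff μ').mpr hμ') (TW (↥(maximalRealSubfield (L : Type))) (-a))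
    (isUnit_det_TW (↥(maximalRealSubfield (L : Type))) (-a)) (JW (↥(maximalRealSubfield (L : Type))) (L : Type) (-a)) (JW_eq (↥(maximalRealSubfield (L : Type))) (L : Type) (-a)))
    p Φ)
    (Φ : piSchwartzBruhat (↥(maximalRealSubfield (L : Type))) (Fin 3))
    (x : UnitaryGroup.adelic (↥(maximalRealSubfield (L : Type))) (L : Type) (IsCMField.complexConj (L : Type)) 3 (Matrix.diagonal (frameD V)))
    (y' : UnitaryGroup.adelic (↥(maximalRealSubfield (L : Type))) (L : Type) (IsCMField.complexConj (L : Type)) 1 (JW (↥(maximalRealSubfield (L : Type))) (L : Type) (-a))) :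
    (lineThetaKernelDatum (L : Type) 3 e₁ (frameD V) (frameD_real V) (frameD_ne V) μ' hμ' (-a) hρ').thetaFun Φ (x, y') =
      conj ((lineThetaKernelDatum (L : Type) 3 e₁ (frameD V) (frameD_real V) (frameD_ne V) μ hμ a hρ).thetaFun
        (piSchwartzBruhatConj (↥(maximalRealSubfield (L : Type))) (Fin 3) Φ)
        (x, MulEquiv.subgroupCongr (K2E2CapArchPairMirrorGlue.adelic_JW_neg_eq (↥(maximalRealSubfield (L : Type))) (L : Type) (IsCMField.complexConj (L : Type)) a) y')) := by
  -- `sChiD` unfolds to the line's `chiSplittingLine` (and the splitting-character proofs are irrelevant): the splitting identity in LINE spelling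
  have hEq' : splittingCongr ↥(maximalRealSubfield (L : Type)) (L : Type) (IsCMField.complexConj (L : Type)) 3 1 e₁ (Matrix.diagonal (frameD V))
        (neg_TW_eq a) (neg_JW_eq a)
        (mirrorSplitting ↥(maximalRealSubfield (L : Type)) (L : Type) (IsCMField.complexConj (L : Type)) 3 1 e₁ (Matrix.diagonal (frameD V))
          (JW ↥(maximalRealSubfield (L : Type)) (L : Type) a)
          (chiSplittingLine (L : Type) e₁ (frameD V) (frameD_real V) (frameD_ne V) (toHeckeCharacter (L : Type) μ) (isUnitary_toHeckeCharacter (L : Type) μ)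
          ((isOscillatorChar_toHeckeCharacter_iff μ).mpr hμ) (TW (↥(maximalRealSubfield (L : Type))) a)
          (isUnit_det_TW (↥(maximalRealSubfield (L : Type))) a) (JW (↥(maximalRealSubfield (L : Type))) (L : Type) a) (JW_eq (↥(maximalRealSubfield (L : Type))) (L : Type) a))) =
      (chiSplittingLine (L : Type) e₁ (frameD V) (frameD_real V) (frameD_ne V) (toHeckeCharacter (L : Type) μ') (isUnitary_toHeckeCharacter (L : Type) μ')
      ((isOscillatorChar_toHeckeCharacter_iff μ').mpr hμ') (TW (↥(maximalRealSubfield (L : Type))) (-a))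
      (isUnit_det_TW (↥(maximalRealSubfield (L : Type))) (-a)) (JW (↥(maximalRealSubfield (L : Type))) (L : Type) (-a)) (JW_eq (↥(maximalRealSubfield (L : Type))) (L : Type) (-a))) := hEq
  -- compatibility and majorants of the mirror splitting read at `(TW (−a), JW (−a))`, transported along `hEq'`
  have hs₂ : (splittingDatum (↥(maximalRealSubfield (L : Type))) (L : Type) (IsCMField.complexConj (L : Type)) 3 1 e₁ (Matrix.diagonal (frameD V))
      (JW (↥(maximalRealSubfield (L : Type))) (L : Type) (-a)) (complexConj_imagUnit (L : Type)) (imagUnit_ne_zero (L : Type)) (imagUnit_mul_self (L : Type))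
      (realDiagonal_isSymm (L : Type) (frameD V) (frameD_real V)) (isSymm_TW (↥(maximalRealSubfield (L : Type))) (-a))
      (isUnit_det_realDiagonal (L : Type) (frameD V) (frameD_real V) (frameD_ne V)) (isUnit_det_TW (↥(maximalRealSubfield (L : Type))) (-a))
      (realDiagonal_map (L : Type) (frameD V) (frameD_real V)).symm (JW_eq (↥(maximalRealSubfield (L : Type))) (L : Type) (-a))).IsCompatible
      (splittingCongr ↥(maximalRealSubfield (L : Type)) (L : Type) (IsCMField.complexConj (L : Type)) 3 1 e₁ (Matrix.diagonal (frameD V))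
        (neg_TW_eq a) (neg_JW_eq a)
        (mirrorSplitting ↥(maximalRealSubfield (L : Type)) (L : Type) (IsCMField.complexConj (L : Type)) 3 1 e₁ (Matrix.diagonal (frameD V))
          (JW ↥(maximalRealSubfield (L : Type)) (L : Type) a)
          (chiSplittingLine (L : Type) e₁ (frameD V) (frameD_real V) (frameD_ne V) (toHeckeCharacter (L : Type) μ) (isUnitary_toHeckeCharacter (L : Type) μ)
          ((isOscillatorChar_toHeckeCharacter_iff μ).mpr hμ) (TW (↥(maximalRealSubfield (L : Type))) a)
          (isUnit_det_TW (↥(maximalRealSubfield (L : Type))) a) (JW (↥(maximalRealSubfield (L : Type))) (L : Type) a) (JW_eq (↥(maximalRealSubfield (L : Type))) (L : Type) a)))) := by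
    rw [hEq']
    exact (isCompatible_chiSplittingLine (L : Type) e₁ (frameD V) (frameD_real V) (frameD_ne V) (toHeckeCharacter (L : Type) μ') (isUnitary_toHeckeCharacter (L : Type) μ')
      ((isOscillatorChar_toHeckeCharacter_iff μ').mpr hμ') (TW (↥(maximalRealSubfield (L : Type))) (-a)) (isSymm_TW (↥(maximalRealSubfield (L : Type))) (-a))
      (isUnit_det_TW (↥(maximalRealSubfield (L : Type))) (-a)) (JW (↥(maximalRealSubfield (L : Type))) (L : Type) (-a)) (JW_eq (↥(maximalRealSubfield (L : Type))) (L : Type) (-a)))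
  have hρ₂ : HasThetaMajorants fun
      (p : ↥(UnitaryGroup.adelic (↥(maximalRealSubfield (L : Type))) (L : Type) (IsCMField.complexConj (L : Type)) 3 (Matrix.diagonal (frameD V))) ×
        ↥(UnitaryGroup.adelic (↥(maximalRealSubfield (L : Type))) (L : Type) (IsCMField.complexConj (L : Type)) 1 (JW (↥(maximalRealSubfield (L : Type))) (L : Type) (-a))))
      (Φ : piSchwartzBruhat (↥(maximalRealSubfield (L : Type))) (Fin 3)) =>
        pairRep (↥(maximalRealSubfield (L : Type))) (L : Type) (IsCMField.complexConj (L : Type)) 3 1 e₁ (Matrix.diagonal (frameD V))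
          (JW (↥(maximalRealSubfield (L : Type))) (L : Type) (-a))
          (splittingCongr ↥(maximalRealSubfield (L : Type)) (L : Type) (IsCMField.complexConj (L : Type)) 3 1 e₁ (Matrix.diagonal (frameD V))
            (neg_TW_eq a) (neg_JW_eq a)
            (mirrorSplitting ↥(maximalRealSubfield (L : Type)) (L : Type) (IsCMField.complexConj (L : Type)) 3 1 e₁ (Matrix.diagonal (frameD V))
              (JW ↥(maximalRealSubfield (L : Type)) (L : Type) a)
              (chiSplittingLine (L : Type) e₁ (frameD V) (frameD_real V) (frameD_ne V) (toHeckeCharacter (L : Type) μ) (isUnitary_toHeckeCharacter (L : Type) μ)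
              ((isOscillatorChar_toHeckeCharacter_iff μ).mpr hμ) (TW (↥(maximalRealSubfield (L : Type))) a)
              (isUnit_det_TW (↥(maximalRealSubfield (L : Type))) a) (JW (↥(maximalRealSubfield (L : Type))) (L : Type) a) (JW_eq (↥(maximalRealSubfield (L : Type))) (L : Type) a)))) p Φ := by
    rw [hEq']
    exact hρ'
  -- ★ kit §3 at `(hT, hJ) := (neg_TW_eq a, neg_JW_eq a)`, in LINE spelling
  have key := K2E2CapArchPairMirrorKit.thetaKernelDatum_mirror_thetaFun (↥(maximalRealSubfield (L : Type))) (L : Type) (IsCMField.complexConj (L : Type))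
    3 1 e₁ (Matrix.diagonal (frameD V)) (JW (↥(maximalRealSubfield (L : Type))) (L : Type) a) (complexConj_imagUnit (L : Type)) (imagUnit_ne_zero (L : Type))
    (imagUnit_mul_self (L : Type)) (realDiagonal_isSymm (L : Type) (frameD V) (frameD_real V)) (isSymm_TW (↥(maximalRealSubfield (L : Type))) a)
    (isUnit_det_realDiagonal (L : Type) (frameD V) (frameD_real V) (frameD_ne V)) (isUnit_det_TW (↥(maximalRealSubfield (L : Type))) a)
    (realDiagonal_map (L : Type) (frameD V) (frameD_real V)).symm (JW_eq (↥(maximalRealSubfield (L : Type))) (L : Type) a)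
    (s := (chiSplittingLine (L : Type) e₁ (frameD V) (frameD_real V) (frameD_ne V) (toHeckeCharacter (L : Type) μ) (isUnitary_toHeckeCharacter (L : Type) μ)
      ((isOscillatorChar_toHeckeCharacter_iff μ).mpr hμ) (TW (↥(maximalRealSubfield (L : Type))) a)
      (isUnit_det_TW (↥(maximalRealSubfield (L : Type))) a) (JW (↥(maximalRealSubfield (L : Type))) (L : Type) a) (JW_eq (↥(maximalRealSubfield (L : Type))) (L : Type) a)))
    (isCompatible_chiSplittingLine (L : Type) e₁ (frameD V) (frameD_real V) (frameD_ne V) (toHeckeCharacter (L : Type) μ) (isUnitary_toHeckeCharacter (L : Type) μ)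
    ((isOscillatorChar_toHeckeCharacter_iff μ).mpr hμ) (TW (↥(maximalRealSubfield (L : Type))) a) (isSymm_TW (↥(maximalRealSubfield (L : Type))) a)
    (isUnit_det_TW (↥(maximalRealSubfield (L : Type))) a) (JW (↥(maximalRealSubfield (L : Type))) (L : Type) a) (JW_eq (↥(maximalRealSubfield (L : Type))) (L : Type) a))
    hρ Set.univ (fun _ _ _ => Set.mem_univ _) (neg_TW_eq a) (neg_JW_eq a)
    (isSymm_TW (↥(maximalRealSubfield (L : Type))) (-a)) (isUnit_det_TW (↥(maximalRealSubfield (L : Type))) (-a))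
    (JW_eq (↥(maximalRealSubfield (L : Type))) (L : Type) (-a)) hs₂ hρ₂ Set.univ (fun _ _ _ => Set.mem_univ _) Φ x
    (MulEquiv.subgroupCongr (K2E2CapArchPairMirrorGlue.adelic_JW_neg_eq (↥(maximalRealSubfield (L : Type))) (L : Type) (IsCMField.complexConj (L : Type)) a) y') y'
    (by rw [MulEquiv.subgroupCongr_apply])
  -- the mirror datum and the `μ′`-datum have the same kernel (§1 along `hEq'`)
  have hc := thetaKernelDatum_thetaFun_congr (↥(maximalRealSubfield (L : Type))) (L : Type) (IsCMField.complexConj (L : Type)) 3 1 e₁ (Matrix.diagonal (frameD V))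
      (JW (↥(maximalRealSubfield (L : Type))) (L : Type) (-a)) (complexConj_imagUnit (L : Type)) (imagUnit_ne_zero (L : Type)) (imagUnit_mul_self (L : Type))
      (realDiagonal_isSymm (L : Type) (frameD V) (frameD_real V)) (isSymm_TW (↥(maximalRealSubfield (L : Type))) (-a))
      (isUnit_det_realDiagonal (L : Type) (frameD V) (frameD_real V) (frameD_ne V)) (isUnit_det_TW (↥(maximalRealSubfield (L : Type))) (-a))
      (realDiagonal_map (L : Type) (frameD V) (frameD_real V)).symm (JW_eq (↥(maximalRealSubfield (L : Type))) (L : Type) (-a)) hEq' hs₂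
      (isCompatible_chiSplittingLine (L : Type) e₁ (frameD V) (frameD_real V) (frameD_ne V) (toHeckeCharacter (L : Type) μ') (isUnitary_toHeckeCharacter (L : Type) μ')
      ((isOscillatorChar_toHeckeCharacter_iff μ').mpr hμ') (TW (↥(maximalRealSubfield (L : Type))) (-a)) (isSymm_TW (↥(maximalRealSubfield (L : Type))) (-a))
      (isUnit_det_TW (↥(maximalRealSubfield (L : Type))) (-a)) (JW (↥(maximalRealSubfield (L : Type))) (L : Type) (-a)) (JW_eq (↥(maximalRealSubfield (L : Type))) (L : Type) (-a)))
      hρ₂ hρ' Set.univ (fun _ _ _ => Set.mem_univ _) (fun _ _ _ => Set.mem_univ _) Φ (x, y')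
  unfold lineThetaKernelDatum
  exact hc.symm.trans key

include hEq in
set_option synthInstance.maxHeartbeats 400000 in
set_option maxHeartbeats 16000000 in
/-- **(K2) ROW (E) TRANSFERS FROM THE PARTNER**: if `a″ ∈ U(J_W(−a))(L⁺ ⊗ ℝ)` fixes `Ψ` under the archimedean Weil representation of the `μ′`-splitting
at `⟨−a⟩` (the #20a (E)-operator at `(frameD V, JW (−a), μ′)`), then the `a′ ∈ U(J_W(a))(L⁺ ⊗ ℝ)` with the same matrix fixes `C_∞ Ψ` under the one of the
`μ`-splitting at `⟨a⟩` (the #20a (E)-operator at `(frameD V, JW a, μ)`) — ★ kit §2 `archWeilRep_schwartzConj_eq_self_of_mirror_eq_self` along `hEq`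
(★ H3 `archWeilRep_congr_splitting`). [cite: Liu2021, App. D Lemma D.1 (2) (l. 5231), Lem. D.2 (2)] [cite: Li1992, p. 181] [cite: KonnoKonno2007, Thm 5.4 p. 75] -/
theorem archWeilRep_line_schwartzConj_eq_self_of_partner
    (a' : UnitaryGroup.arch (↥(maximalRealSubfield (L : Type))) (L : Type) (IsCMField.complexConj (L : Type)) 1 (JW (↥(maximalRealSubfield (L : Type))) (L : Type) a))
    (a'' : UnitaryGroup.arch (↥(maximalRealSubfield (L : Type))) (L : Type) (IsCMField.complexConj (L : Type)) 1 (JW (↥(maximalRealSubfield (L : Type))) (L : Type) (-a)))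
    (h : ((a'' : GL (Fin 1) (mixedSpace (L : Type))) = (a' : GL (Fin 1) (mixedSpace (L : Type)))))
    {Ψ : 𝓢((Fin 3 → mixedSpace (↥(maximalRealSubfield (L : Type)))), ℂ)}
    (hfix : HodgeCM.Model.HypCensus.archWeilRep (↥(maximalRealSubfield (L : Type))) (L : Type) (IsCMField.complexConj (L : Type)) 3 1 (Matrix.diagonal (frameD V))
      (JW (↥(maximalRealSubfield (L : Type))) (L : Type) (-a)) (complexConj_imagUnit (L : Type)) (imagUnit_ne_zero (L : Type)) (imagUnit_mul_self (L : Type)) (realDiagonal_isSymm (L : Type) (frameD V) (frameD_real V))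
      (isSymm_TW (↥(maximalRealSubfield (L : Type))) (-a)) (isUnit_det_realDiagonal (L : Type) (frameD V) (frameD_real V) (frameD_ne V)) (isUnit_det_TW (↥(maximalRealSubfield (L : Type))) (-a))
      (realDiagonal_map (L : Type) (frameD V) (frameD_real V)).symm (JW_eq (↥(maximalRealSubfield (L : Type))) (L : Type) (-a)) e₁
      (chiSplittingLine (L : Type) e₁ (frameD V) (frameD_real V) (frameD_ne V) (toHeckeCharacter (L : Type) μ') (isUnitary_toHeckeCharacter (L : Type) μ')
      ((isOscillatorChar_toHeckeCharacter_iff μ').mpr hμ') (TW (↥(maximalRealSubfield (L : Type))) (-a))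
      (isUnit_det_TW (↥(maximalRealSubfield (L : Type))) (-a)) (JW (↥(maximalRealSubfield (L : Type))) (L : Type) (-a)) (JW_eq (↥(maximalRealSubfield (L : Type))) (L : Type) (-a)))
      (ThetaNonvanishing.proj_apply_eq_toSp (↥(maximalRealSubfield (L : Type))) (L : Type) (IsCMField.complexConj (L : Type)) 3 1 e₁ (Matrix.diagonal (frameD V))
      (JW (↥(maximalRealSubfield (L : Type))) (L : Type) (-a)) (complexConj_imagUnit (L : Type)) (imagUnit_ne_zero (L : Type)) (imagUnit_mul_self (L : Type)) (realDiagonal_isSymm (L : Type) (frameD V) (frameD_real V))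
      (isSymm_TW (↥(maximalRealSubfield (L : Type))) (-a)) (isUnit_det_realDiagonal (L : Type) (frameD V) (frameD_real V) (frameD_ne V)) (isUnit_det_TW (↥(maximalRealSubfield (L : Type))) (-a))
      (realDiagonal_map (L : Type) (frameD V) (frameD_real V)).symm (JW_eq (↥(maximalRealSubfield (L : Type))) (L : Type) (-a))
      (isCompatible_chiSplittingLine (L : Type) e₁ (frameD V) (frameD_real V) (frameD_ne V) (toHeckeCharacter (L : Type) μ') (isUnitary_toHeckeCharacter (L : Type) μ')
      ((isOscillatorChar_toHeckeCharacter_iff μ').mpr hμ') (TW (↥(maximalRealSubfield (L : Type))) (-a)) (isSymm_TW (↥(maximalRealSubfield (L : Type))) (-a))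
      (isUnit_det_TW (↥(maximalRealSubfield (L : Type))) (-a)) (JW (↥(maximalRealSubfield (L : Type))) (L : Type) (-a)) (JW_eq (↥(maximalRealSubfield (L : Type))) (L : Type) (-a))))
      (1, a'') Ψ = Ψ) :
    HodgeCM.Model.HypCensus.archWeilRep (↥(maximalRealSubfield (L : Type))) (L : Type) (IsCMField.complexConj (L : Type)) 3 1 (Matrix.diagonal (frameD V))
      (JW (↥(maximalRealSubfield (L : Type))) (L : Type) a) (complexConj_imagUnit (L : Type)) (imagUnit_ne_zero (L : Type)) (imagUnit_mul_self (L : Type)) (realDiagonal_isSymm (L : Type) (frameD V) (frameD_real V))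
      (isSymm_TW (↥(maximalRealSubfield (L : Type))) a) (isUnit_det_realDiagonal (L : Type) (frameD V) (frameD_real V) (frameD_ne V)) (isUnit_det_TW (↥(maximalRealSubfield (L : Type))) a)
      (realDiagonal_map (L : Type) (frameD V) (frameD_real V)).symm (JW_eq (↥(maximalRealSubfield (L : Type))) (L : Type) a) e₁
      (chiSplittingLine (L : Type) e₁ (frameD V) (frameD_real V) (frameD_ne V) (toHeckeCharacter (L : Type) μ) (isUnitary_toHeckeCharacter (L : Type) μ)
      ((isOscillatorChar_toHeckeCharacter_iff μ).mpr hμ) (TW (↥(maximalRealSubfield (L : Type))) a)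
      (isUnit_det_TW (↥(maximalRealSubfield (L : Type))) a) (JW (↥(maximalRealSubfield (L : Type))) (L : Type) a) (JW_eq (↥(maximalRealSubfield (L : Type))) (L : Type) a))
      (ThetaNonvanishing.proj_apply_eq_toSp (↥(maximalRealSubfield (L : Type))) (L : Type) (IsCMField.complexConj (L : Type)) 3 1 e₁ (Matrix.diagonal (frameD V))
      (JW (↥(maximalRealSubfield (L : Type))) (L : Type) a) (complexConj_imagUnit (L : Type)) (imagUnit_ne_zero (L : Type)) (imagUnit_mul_self (L : Type)) (realDiagonal_isSymm (L : Type) (frameD V) (frameD_real V))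
      (isSymm_TW (↥(maximalRealSubfield (L : Type))) a) (isUnit_det_realDiagonal (L : Type) (frameD V) (frameD_real V) (frameD_ne V)) (isUnit_det_TW (↥(maximalRealSubfield (L : Type))) a)
      (realDiagonal_map (L : Type) (frameD V) (frameD_real V)).symm (JW_eq (↥(maximalRealSubfield (L : Type))) (L : Type) a)
      (isCompatible_chiSplittingLine (L : Type) e₁ (frameD V) (frameD_real V) (frameD_ne V) (toHeckeCharacter (L : Type) μ) (isUnitary_toHeckeCharacter (L : Type) μ)
      ((isOscillatorChar_toHeckeCharacter_iff μ).mpr hμ) (TW (↥(maximalRealSubfield (L : Type))) a) (isSymm_TW (↥(maximalRealSubfield (L : Type))) a)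
      (isUnit_det_TW (↥(maximalRealSubfield (L : Type))) a) (JW (↥(maximalRealSubfield (L : Type))) (L : Type) a) (JW_eq (↥(maximalRealSubfield (L : Type))) (L : Type) a)))
      (1, a') (schwartzConj Ψ) = schwartzConj Ψ := by
  -- the projection clause of the mirror splitting read at `(TW (−a), JW (−a))`, along `hEq`
  have hs₂ : ∀ g, adelicMpCont.proj (↥(maximalRealSubfield (L : Type))) (Fin 3)
        (adelicGram (↥(maximalRealSubfield (L : Type))) e₁ (realDiagonal (L : Type) (frameD V) (frameD_real V)) (TW (↥(maximalRealSubfield (L : Type))) (-a)))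
        (splittingCongr ↥(maximalRealSubfield (L : Type)) (L : Type) (IsCMField.complexConj (L : Type)) 3 1 e₁ (Matrix.diagonal (frameD V))
          (neg_TW_eq a) (neg_JW_eq a)
          (mirrorSplitting ↥(maximalRealSubfield (L : Type)) (L : Type) (IsCMField.complexConj (L : Type)) 3 1 e₁ (Matrix.diagonal (frameD V))
            (JW ↥(maximalRealSubfield (L : Type)) (L : Type) a)
            (sChiD (⟨HodgeCM.CMField.K L⟩ : Summit.HodgeConjecture.CorCM.CMField) e₁ (frameD V) (frameD_real V) (frameD_ne V)
              (toHeckeCharacter (L : Type) μ) (isUnitary_toHeckeCharacter (L : Type) μ)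
              (isSplittingChar_toHeckeCharacter_of_isConjugateSymplectic (L : Type) μ hμ) a)) g) =
      toSp (↥(maximalRealSubfield (L : Type))) (L : Type) (IsCMField.complexConj (L : Type)) 3 1 e₁ (Matrix.diagonal (frameD V))
        (JW (↥(maximalRealSubfield (L : Type))) (L : Type) (-a)) (complexConj_imagUnit (L : Type)) (imagUnit_ne_zero (L : Type)) (imagUnit_mul_self (L : Type))
        (realDiagonal_isSymm (L : Type) (frameD V) (frameD_real V)) (isSymm_TW (↥(maximalRealSubfield (L : Type))) (-a))
        (realDiagonal_map (L : Type) (frameD V) (frameD_real V)).symm (JW_eq (↥(maximalRealSubfield (L : Type))) (L : Type) (-a)) g := by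
    rw [hEq]
    exact ThetaNonvanishing.proj_apply_eq_toSp (↥(maximalRealSubfield (L : Type))) (L : Type) (IsCMField.complexConj (L : Type)) 3 1 e₁ (Matrix.diagonal (frameD V))
      (JW (↥(maximalRealSubfield (L : Type))) (L : Type) (-a)) (complexConj_imagUnit (L : Type)) (imagUnit_ne_zero (L : Type)) (imagUnit_mul_self (L : Type))
      (realDiagonal_isSymm (L : Type) (frameD V) (frameD_real V)) (isSymm_TW (↥(maximalRealSubfield (L : Type))) (-a))
      (isUnit_det_realDiagonal (L : Type) (frameD V) (frameD_real V) (frameD_ne V)) (isUnit_det_TW (↥(maximalRealSubfield (L : Type))) (-a))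
      (realDiagonal_map (L : Type) (frameD V) (frameD_real V)).symm (JW_eq (↥(maximalRealSubfield (L : Type))) (L : Type) (-a))
      (hsChiD (⟨HodgeCM.CMField.K L⟩ : Summit.HodgeConjecture.CorCM.CMField) e₁ (frameD V) (frameD_real V) (frameD_ne V)
        (toHeckeCharacter (L : Type) μ') (isUnitary_toHeckeCharacter (L : Type) μ')
        (isSplittingChar_toHeckeCharacter_of_isConjugateSymplectic (L : Type) μ' hμ') (-a))
  -- read `hfix` at the mirror splitting (★ H3 `archWeilRep_congr_splitting` along `hEq.symm`; `sChiD` unfolds to the line's `chiSplittingLine`)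
  have hcongr := K2E2CapArchPairFixedNeZero.archWeilRep_congr_splitting (↥(maximalRealSubfield (L : Type))) (L : Type) (IsCMField.complexConj (L : Type)) 3 1
      (Matrix.diagonal (frameD V)) (JW (↥(maximalRealSubfield (L : Type))) (L : Type) (-a)) (complexConj_imagUnit (L : Type)) (imagUnit_ne_zero (L : Type))
      (imagUnit_mul_self (L : Type)) (realDiagonal_isSymm (L : Type) (frameD V) (frameD_real V)) (isSymm_TW (↥(maximalRealSubfield (L : Type))) (-a))
      (isUnit_det_realDiagonal (L : Type) (frameD V) (frameD_real V) (frameD_ne V)) (isUnit_det_TW (↥(maximalRealSubfield (L : Type))) (-a))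
      (realDiagonal_map (L : Type) (frameD V) (frameD_real V)).symm (JW_eq (↥(maximalRealSubfield (L : Type))) (L : Type) (-a)) e₁
      (chiSplittingLine (L : Type) e₁ (frameD V) (frameD_real V) (frameD_ne V) (toHeckeCharacter (L : Type) μ') (isUnitary_toHeckeCharacter (L : Type) μ')
      ((isOscillatorChar_toHeckeCharacter_iff μ').mpr hμ') (TW (↥(maximalRealSubfield (L : Type))) (-a))
      (isUnit_det_TW (↥(maximalRealSubfield (L : Type))) (-a)) (JW (↥(maximalRealSubfield (L : Type))) (L : Type) (-a)) (JW_eq (↥(maximalRealSubfield (L : Type))) (L : Type) (-a)))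
      (ThetaNonvanishing.proj_apply_eq_toSp (↥(maximalRealSubfield (L : Type))) (L : Type) (IsCMField.complexConj (L : Type)) 3 1 e₁ (Matrix.diagonal (frameD V))
      (JW (↥(maximalRealSubfield (L : Type))) (L : Type) (-a)) (complexConj_imagUnit (L : Type)) (imagUnit_ne_zero (L : Type)) (imagUnit_mul_self (L : Type)) (realDiagonal_isSymm (L : Type) (frameD V) (frameD_real V))
      (isSymm_TW (↥(maximalRealSubfield (L : Type))) (-a)) (isUnit_det_realDiagonal (L : Type) (frameD V) (frameD_real V) (frameD_ne V)) (isUnit_det_TW (↥(maximalRealSubfield (L : Type))) (-a))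
      (realDiagonal_map (L : Type) (frameD V) (frameD_real V)).symm (JW_eq (↥(maximalRealSubfield (L : Type))) (L : Type) (-a))
      (isCompatible_chiSplittingLine (L : Type) e₁ (frameD V) (frameD_real V) (frameD_ne V) (toHeckeCharacter (L : Type) μ') (isUnitary_toHeckeCharacter (L : Type) μ')
      ((isOscillatorChar_toHeckeCharacter_iff μ').mpr hμ') (TW (↥(maximalRealSubfield (L : Type))) (-a)) (isSymm_TW (↥(maximalRealSubfield (L : Type))) (-a))
      (isUnit_det_TW (↥(maximalRealSubfield (L : Type))) (-a)) (JW (↥(maximalRealSubfield (L : Type))) (L : Type) (-a)) (JW_eq (↥(maximalRealSubfield (L : Type))) (L : Type) (-a))))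
      hEq.symm hs₂
  rw [hcongr] at hfix
  -- ★ kit §2
  exact K2E2CapArchPairMirrorKit.archWeilRep_schwartzConj_eq_self_of_mirror_eq_self (↥(maximalRealSubfield (L : Type))) (L : Type)
    (IsCMField.complexConj (L : Type)) 3 1 e₁ (Matrix.diagonal (frameD V)) (JW (↥(maximalRealSubfield (L : Type))) (L : Type) a)
    (complexConj_imagUnit (L : Type)) (imagUnit_ne_zero (L : Type)) (imagUnit_mul_self (L : Type)) (realDiagonal_isSymm (L : Type) (frameD V) (frameD_real V))
    (isSymm_TW (↥(maximalRealSubfield (L : Type))) a) (isUnit_det_realDiagonal (L : Type) (frameD V) (frameD_real V) (frameD_ne V))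
    (isUnit_det_TW (↥(maximalRealSubfield (L : Type))) a) (realDiagonal_map (L : Type) (frameD V) (frameD_real V)).symm
    (JW_eq (↥(maximalRealSubfield (L : Type))) (L : Type) a) _ _ (neg_TW_eq a) (neg_JW_eq a) (isSymm_TW (↥(maximalRealSubfield (L : Type))) (-a))
    (isUnit_det_TW (↥(maximalRealSubfield (L : Type))) (-a)) (JW_eq (↥(maximalRealSubfield (L : Type))) (L : Type) (-a)) hs₂ 1 a' a'' h hfix

end PKG

end Summit.HodgeConjecture.HodgeConjecture.Cruxes.H413.K2E2CapArchPairMirrorAtPKG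

end
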